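import Summits.BirchSwinnertonDyer.BirchSwinnertonDyer.Theorems.UniversalToricDescentTwinMuZeroAtThreeGoodOfBCS
import HarnessLib

/-!
# RK-7 prover glue: the T-restriction of `TwinMuZeroAtThree` (stmt-BirchSwinnertonDyer-20400) is
# «BCS 2025 Prop. 4.2.2 (print leaf `BCSMuZeroInput`, stmt-…-20790)» ⊕ «the multiplicative très-ramifié residue at odd `d_K`»

Width prover `bsd-wall-utd-p1-w2` g7 under LEAD `bsd-wall-utd-p1` g20 (route `UniversalToricDescent`, `--supports
stmt-BirchSwinnertonDyer-20400`). Context: the LEAD's finding (STATUS 2026-08-29T13:10:03Z, file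
`…TwinMuZeroAtThreeGoodOfBCS`, p720953) that `TwinMuZeroAtThree` on GOOD twins at odd `d_K` is print modulo the named fact
`h422 = BurungaleCastellaSkinner2025.prop422_exists_isBDPLFunction_mu_eq_zero` (= the aside item `BCSMuZeroInput`), and the pen's
booked re-key RK-7 (`Cruxes/ToricTransportModThree/PEN-MEMO-RK7-v1.md`, sketch `RK7_sketch_pen_g8.lean` sha16 51f2aaf68cacd05b):
two NEW items, `TwinMuZeroAtThreeT` (20400's text restricted to the consumer-read rows: `Odd (NumberField.discr K)` and the
kernel's twin buckets GoodOrd ∨ Mult ∧ très-ramifié ∨ GoodSS ∧ `a₃ = 0`) and `TwinMuZeroAtThreeMultOdd` (the research residue B),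
plus a prover glue `BCSMuZeroInput → TwinMuZeroAtThreeMultOdd → TwinMuZeroAtThreeT`. THIS FILE IS THAT GLUE, kernel-checked on
the pen's texts VERBATIM (stated as displayed hypothesis / conclusion, so that once the items exist the closer of the glue item is
`fun h422 hB => twinMuZeroAtThreeT_of_bcs422_of_multOdd h422 hB`), and it answers the memo's item-3 question: p720953's pointwise
theorem `exists_norm_coeff_eq_one_of_good_of_bcs422` asks only `W′.HasGoodReductionAtPrime 3` (ordinary OR supersingular, any
`a₃`), so BOTH good disjuncts of the bucket guard are print and the glue has exactly the two antecedents `h422` and B.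

* `twinMuZeroAtThreeT_of_bcs422_of_multOdd` — `h422 → <TwinMuZeroAtThreeMultOdd text> → <TwinMuZeroAtThreeT text>`.
* `twinMuZeroAtThreeT_pointwise_of_bcs422` — the same pointwise at one twin datum, with the B-bucket input asked only for THIS twin
  (the shape a kernel trichotomy consumes).

THEOREMS ONLY; no definition, no new named fact (the displayed `h422` is the tree's existing Literature `def`), no `sorry`, imports no
`Theses` module. HONEST FRAMING: implications between (candidate) route items and one displayed printed hypothesis; the B residue
(`3 ∥ N′`, 675 très-ramifié classes) stays research; BSD is proved for no curve by this file.
References: [BurungaleCastellaSkinner2025] Prop. 4.2.2 (§4.2, pp. 8–9 of arXiv:2405.00270v2); [Hsieh2014] Thm. B.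
-/

noncomputable section

open scoped Classical

set_option linter.dupNamespace false
set_option autoImplicit false

namespace Summit.BirchSwinnertonDyer.BirchSwinnertonDyer.Theorems.UniversalToricDescentTwinMuZeroT

open WeierstrassCurve NumberField IsDedekindDomain Field
  Literature.NumberTheory.EllipticCurves
  Literature.NumberTheory.EllipticCurves.ModularForms
  Literature.NumberTheory.EllipticCurves.Rank1Residual
  Summit.BirchSwinnertonDyer.Rank1Residual
  Summit.BirchSwinnertonDyer.BirchSwinnertonDyer.Theorems.SchneiderFree
  Summit.BirchSwinnertonDyer.BirchSwinnertonDyer.Theorems.UniversalToricDescentTwinMuZeroGood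

/-- **RK-7 glue: `BCSMuZeroInput → TwinMuZeroAtThreeMultOdd → TwinMuZeroAtThreeT`** (pen pss3x g8 memo RK-7 v1, item 3), on the
pen's texts VERBATIM (`RK7_sketch_pen_g8.lean` 51f2aaf68cacd05b: 2150 / 1989 characters). Case split on the bucket guard of the
T-text: GoodOrd and GoodSS ∧ `a₃ = 0` are GOOD reduction, where `twinMuZeroAtThree_good_odd_of_bcs422 h422` (p720953: BCS Prop. 4.2.2
frame + cross-period rigidity) gives the norm-one coefficient; Mult ∧ très-ramifié is the displayed hypothesis `hB` verbatim.
CONDITIONAL on the displayed named fact `h422` and on `hB`; BSD is proved for no curve by this.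
[cite: BurungaleCastellaSkinner2025, Prop. 4.2.2 (§4.2, pp. 8–9 of arXiv:2405.00270v2)] [cite: Hsieh2014, Thm. B] -/
theorem twinMuZeroAtThreeT_of_bcs422_of_multOdd
    (h422 : BurungaleCastellaSkinner2025.prop422_exists_isBDPLFunction_mu_eq_zero)
    (hB : ∀ (W : WeierstrassCurve ℚ) [W.IsElliptic] [W.IsGloballyMinimal] (W' : WeierstrassCurve ℚ) [W'.IsElliptic] [W'.IsGloballyMinimal] (N N' : ℕ) [NeZero N] [NeZero N'] (K : Type) [Field K] [NumberField K] (Dt : Literature.NumberTheory.EllipticCurves.ModularForms.ModularParametrizationData W N) (Dt' : Literature.NumberTheory.EllipticCurves.ModularForms.ModularParametrizationData W' N'), Summit.BirchSwinnertonDyer.Rank1Residual.Additive.ClassO6 W 3 → W.HasSurjectiveModNGaloisRep 3 → W.analyticRank = 1 → W.conductorNorm ℤ = N → Summit.BirchSwinnertonDyer.Rank1Residual.O6.ModPCongruent W' W 3 → ¬ Literature.NumberTheory.EllipticCurves.Rank1Residual.Addv W' 3 → W'.conductorNorm ℤ = N' → Literature.NumberTheory.EllipticCurves.IsImaginaryQuadratic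 K → Literature.NumberTheory.EllipticCurves.SatisfiesHeegnerHypothesis N K → Literature.NumberTheory.EllipticCurves.SatisfiesHeegnerHypothesis N' K → Odd (NumberField.discr K) → (Literature.NumberTheory.EllipticCurves.Rank1Residual.Mult W' 3 ∧ ¬ 3 ∣ padicValInt 3 W'.minimalDiscriminantInt) → ∀ (κ : Literature.NumberTheory.EllipticCurves.ZpExtension K 3), κ.IsAnticyclotomic → ∀ (γ : Field.absoluteGaloisGroup K) [Fact (κ.IsTopGenerator γ)] (𝔭 : IsDedekindDomain.HeightOneSpectrum (NumberField.RingOfIntegers K)), ((3 : ℕ) : NumberField.RingOfIntegers K) ∈ 𝔭.asIdeal → 𝔭.asIdeal.ramificationIdx (NumberField.RingOfIntegers ℚ) = 1 → 𝔭.asIdeal.inertiaDeg (NumberField.RingOfIntegers ℚ) = 1 → ∀ (𝔭' : IsDedekindDomain.HeightOneSpectrum (NumberField.RingOfIntegers K)), ((3 : ℕ) : NumberField.RingOfIntegers K) ∈ 𝔭'.asIdeal → 𝔭' ≠ 𝔭 → ∀ (ι' : PadicAlgCl 3 ≃+* ℂ), Summit.BirchSwinnertonDyer.BirchSwinnertonDyer.Theorems.SchneiderFree.BranchInducesPrime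 3 ι' 𝔭 → ∀ (ΩK : ℂ) (Ωp : ℂ_[3]) (L' : Literature.NumberTheory.EllipticCurves.UnrSeries 3), ΩK ≠ 0 → Ωp ≠ 0 → Literature.NumberTheory.EllipticCurves.IsBDPLFunction ι' 𝔭 κ γ Dt'.f ΩK Ωp L' → ∃ i : ℕ, ‖((PowerSeries.coeff i L' : Literature.NumberTheory.EllipticCurves.unrIntegers 3) : ℂ_[3])‖ = 1) :
    ∀ (W : WeierstrassCurve ℚ) [W.IsElliptic] [W.IsGloballyMinimal] (W' : WeierstrassCurve ℚ) [W'.IsElliptic] [W'.IsGloballyMinimal] (N N' : ℕ) [NeZero N] [NeZero N'] (K : Type) [Field K] [NumberField K] (Dt : Literature.NumberTheory.EllipticCurves.ModularForms.ModularParametrizationData W N) (Dt' : Literature.NumberTheory.EllipticCurves.ModularForms.ModularParametrizationData W' N'), Summit.BirchSwinnertonDyer.Rank1Residual.Additive.ClassO6 W 3 → W.HasSurjectiveModNGaloisRep 3 → W.analyticRank = 1 → W.conductorNorm ℤ = N → Summit.BirchSwinnertonDyer.Rank1Residual.O6.ModPCongruent W' W 3 → ¬ Literature.NumberTheory.EllipticCurves.Rank1Residual.Addv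 W' 3 → W'.conductorNorm ℤ = N' → Literature.NumberTheory.EllipticCurves.IsImaginaryQuadratic K → Literature.NumberTheory.EllipticCurves.SatisfiesHeegnerHypothesis N K → Literature.NumberTheory.EllipticCurves.SatisfiesHeegnerHypothesis N' K → Odd (NumberField.discr K) → (Literature.NumberTheory.EllipticCurves.Rank1Residual.GoodOrd W' 3 ∨ Literature.NumberTheory.EllipticCurves.Rank1Residual.Mult W' 3 ∧ ¬ 3 ∣ padicValInt 3 W'.minimalDiscriminantInt ∨ Literature.NumberTheory.EllipticCurves.Rank1Residual.GoodSS W' 3 ∧ W'.frobeniusTrace 3 = 0) → ∀ (κ : Literature.NumberTheory.EllipticCurves.ZpExtension K 3), κ.IsAnticyclotomic → ∀ (γ : Field.absoluteGaloisGroup K) [Fact (κ.IsTopGenerator γ)] (𝔭 : IsDedekindDomain.HeightOneSpectrum (NumberField.RingOfIntegers K)), ((3 : ℕ) : NumberField.RingOfIntegers K) ∈ 𝔭.asIdeal → 𝔭.asIdeal.ramificationIdx (NumberField.RingOfIntegers ℚ) = 1 → 𝔭.asIdeal.inertiaDeg (NumberField.RingOfIntegers ℚ) = 1 → ∀ (𝔭'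 : IsDedekindDomain.HeightOneSpectrum (NumberField.RingOfIntegers K)), ((3 : ℕ) : NumberField.RingOfIntegers K) ∈ 𝔭'.asIdeal → 𝔭' ≠ 𝔭 → ∀ (ι' : PadicAlgCl 3 ≃+* ℂ), Summit.BirchSwinnertonDyer.BirchSwinnertonDyer.Theorems.SchneiderFree.BranchInducesPrime 3 ι' 𝔭 → ∀ (ΩK : ℂ) (Ωp : ℂ_[3]) (L' : Literature.NumberTheory.EllipticCurves.UnrSeries 3), ΩK ≠ 0 → Ωp ≠ 0 → Literature.NumberTheory.EllipticCurves.IsBDPLFunction ι' 𝔭 κ γ Dt'.f ΩK Ωp L' → ∃ i : ℕ, ‖((PowerSeries.coeff i L' : Literature.NumberTheory.EllipticCurves.unrIntegers 3) : ℂ_[3])‖ = 1 := by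
  intro W _ _ W' _ _ N N' _ _ K _ _ Dt Dt' hO6 hsurj hrk hN hcong hAddv hN' hK hH hH' hodd hbucket κ hκ γ _ 𝔭 h𝔭 he hf 𝔭'
    h𝔭' hne ι' hι' ΩK Ωp L' hΩK hΩp hL'
  rcases hbucket with hgo | hmult | hss
  · exact twinMuZeroAtThree_good_odd_of_bcs422 h422 W W' N N' K Dt Dt' hO6 hsurj hrk hN hcong hgo.1 hN' hK hH hH' hodd κ hκ
      γ 𝔭 h𝔭 he hf 𝔭' h𝔭' hne ι' hι' ΩK Ωp L' hΩK hΩp hL'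
  · exact hB W W' N N' K Dt Dt' hO6 hsurj hrk hN hcong hAddv hN' hK hH hH' hodd hmult κ hκ γ 𝔭 h𝔭 he hf 𝔭' h𝔭' hne ι' hι'
      ΩK Ωp L' hΩK hΩp hL'
  · exact twinMuZeroAtThree_good_odd_of_bcs422 h422 W W' N N' K Dt Dt' hO6 hsurj hrk hN hcong hss.1.1 hN' hK hH hH' hodd κ hκ
      γ 𝔭 h𝔭 he hf 𝔭' h𝔭' hne ι' hι' ΩK Ωp L' hΩK hΩp hL'

/-- **The same, pointwise at one twin datum** (the shape a kernel's twin trichotomy consumes): for a twin `W′` of the wild curve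
`W` in one of the kernel buckets, a Heegner `K` with `d_K` odd, a degree-one `𝔭 ∋ 3` and `ι′` inducing `𝔭` (no `𝔭′` needed), EVERY frame of
`f_{W′}` has a norm-one coefficient — from `h422` on the two good buckets and from the displayed B-input `hBμ` (asked for THIS
twin only, in the binder order of the B-text after the curve data) on the multiplicative très-ramifié bucket. The mod-`3` image of
`W′` is onto along `W′[3] ≃ W[3]` (`GaloisImage.hasSurjectiveModNGaloisRep_of_torsionIso`). CONDITIONAL on `h422` / `hBμ`; BSD is
proved for no curve by this. [cite: BurungaleCastellaSkinner2025, Prop. 4.2.2 (§4.2, pp. 8–9 of arXiv:2405.00270v2)] -/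
theorem exists_norm_coeff_eq_one_of_bucket_of_bcs422
    (h422 : BurungaleCastellaSkinner2025.prop422_exists_isBDPLFunction_mu_eq_zero)
    (W : WeierstrassCurve ℚ) [W.IsElliptic] (W' : WeierstrassCurve ℚ) [W'.IsElliptic] [W'.IsGloballyMinimal] (N' : ℕ) [NeZero N']
    (K : Type) [Field K] [NumberField K] (Dt' : ModularParametrizationData W' N')
    (hsurj : W.HasSurjectiveModNGaloisRep 3) (hcong : O6.ModPCongruent W' W 3)
    (hbucket : GoodOrd W' 3 ∨ Mult W' 3 ∧ ¬ 3 ∣ padicValInt 3 W'.minimalDiscriminantInt ∨ GoodSS W' 3 ∧ W'.frobeniusTrace 3 = 0)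
    (hK : IsImaginaryQuadratic K) (hH' : SatisfiesHeegnerHypothesis N' K) (hodd : Odd (NumberField.discr K))
    (κ : ZpExtension K 3) (hκ : κ.IsAnticyclotomic) (γ : absoluteGaloisGroup K) [Fact (κ.IsTopGenerator γ)]
    (𝔭 : HeightOneSpectrum (𝓞 K)) (h𝔭 : ((3 : ℕ) : 𝓞 K) ∈ 𝔭.asIdeal)
    (he : 𝔭.asIdeal.ramificationIdx (𝓞 ℚ) = 1) (hf : 𝔭.asIdeal.inertiaDeg (𝓞 ℚ) = 1)
    (ι' : PadicAlgCl 3 ≃+* ℂ) (hι' : BranchInducesPrime 3 ι' 𝔭)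
    (hBμ : Mult W' 3 ∧ ¬ 3 ∣ padicValInt 3 W'.minimalDiscriminantInt →
      ∀ (ΩK : ℂ) (Ωp : ℂ_[3]) (L' : UnrSeries 3), ΩK ≠ 0 → Ωp ≠ 0 → IsBDPLFunction ι' 𝔭 κ γ Dt'.f ΩK Ωp L' →
        ∃ i : ℕ, ‖((PowerSeries.coeff i L' : unrIntegers 3) : ℂ_[3])‖ = 1)
    {ΩK : ℂ} {Ωp : ℂ_[3]} {L' : UnrSeries 3} (hΩK : ΩK ≠ 0) (hΩp : Ωp ≠ 0)
    (hL' : IsBDPLFunction ι' 𝔭 κ γ Dt'.f ΩK Ωp L') :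
    ∃ i : ℕ, ‖((PowerSeries.coeff i L' : unrIntegers 3) : ℂ_[3])‖ = 1 := by
  -- onto image passes along `W′[3] ≅ W[3]`
  have hsurj' : W'.HasSurjectiveModNGaloisRep 3 := by
    obtain ⟨e, he⟩ := hcong
    refine GaloisImage.hasSurjectiveModNGaloisRep_of_torsionIso e.symm (fun σ Q ↦ ?_) hsurj
    apply e.injective
    rw [he, e.apply_symm_apply, e.apply_symm_apply]
  rcases hbucket with hgo | hmult | hss
  · exact exists_norm_coeff_eq_one_of_good_of_bcs422 h422 W' N' K Dt' hgo.1 hsurj' hK hH' hodd κ hκ γ 𝔭 h𝔭 he hf ι' hι'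
      hΩK hΩp hL'
  · exact hBμ hmult ΩK Ωp L' hΩK hΩp hL'
  · exact exists_norm_coeff_eq_one_of_good_of_bcs422 h422 W' N' K Dt' hss.1.1 hsurj' hK hH' hodd κ hκ γ 𝔭 h𝔭 he hf ι' hι'
      hΩK hΩp hL'

end Summit.BirchSwinnertonDyer.BirchSwinnertonDyer.Theorems.UniversalToricDescentTwinMuZeroT

end
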